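import Mathlib.Algebra.Order.BigOperators.Group.Finset
import Mathlib.Data.List.GetD
import Literature.Computability.Complexity.CircuitComposition
import HarnessLib

/-!
# Light cones of bounded fan-in circuits

Trunk `CplxCore` (Boolean circuits as straight-line programs, `Circuit ι` of
`Literature.Computability.Complexity.Circuit`).

For a single-output circuit `C` over input variables `ι` we define its (backward) *light cone*
`C.lightCone : Finset ι`, the set of input variables from which the output wire is reachable in
the underlying DAG, and prove the two facts used in every "shallow circuits are local"
argument:

* `Circuit.eval_congr_lightCone`: the output only depends on the restriction of the input to
  the light cone;
* `Circuit.card_lightCone_le`: if every gate has fan-in `≤ K` (`1 ≤ K`), the light cone has at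
  most `K ^ depth` elements; in particular `≤ 2 ^ depth` over the basis `B₂`
  (`Circuit.card_lightCone_le_two_pow`).

This is Eq. (5) of Bravyi–Gosset–König, *Quantum advantage with shallow circuits*, Science 362
(2018) / arXiv:1704.00690, §2 ("`|L(z_k)| ≤ K^d`"), stated there without proof; the proof is
the evident induction along the straight-line program.

## Design

Both facts are proved for bare gate lists first (`GateList.deps`, `GateList.depths`, computed
by the same left fold as `Circuit.wireVals` / `Circuit.depthVals`, so that
`Circuit.depthVals C (fun _ => 1) = GateList.depths C.gates` holds by `rfl`), by reverse
induction on the program; no well-formedness is needed because out-of-range back-references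
read the default value in all three folds.

## References

* S. Bravyi, D. Gosset, R. König, *Quantum advantage with shallow circuits*, Science 362 (2018)
  308–311, arXiv:1704.00690, §2, Eq. (5).
* H. Vollmer, *Introduction to Circuit Complexity* (1999), §1.2 (depth, fan-in).
-/

namespace Literature.Computability.Complexity

open Finset

variable {ι : Type*}

namespace GateList

/-! ### Syntactic dependencies of the gates of a program -/

/-- The set of input variables read (transitively) by a gate `g` placed behind a program whose
gates have dependency sets `ds`: the union over the argument wires of `{i}` for an input wire
`inl i` and of `ds[m]` for a gate wire `inr m` (junk `∅` out of range).
(Bravyi–Gosset–König 2018, §2, light cone `L(z_k)`.) [cite: BravyiGossetKonigScience2018, §2 Eq. (5)] -/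
def depOf [DecidableEq ι] (ds : List (Finset ι)) (g : Gate ι) : Finset ι :=
  univ.biUnion fun a => match g.args a with
    | .inl i => {i}
    | .inr m => ds.getD m ∅

/-- The dependency sets (backward light cones) of all gates of the program `gs`, in program
order. (Bravyi–Gosset–König 2018, §2.) [cite: BravyiGossetKonigScience2018, §2 Eq. (5)] -/
def deps [DecidableEq ι] (gs : List (Gate ι)) : List (Finset ι) :=
  gs.foldl (fun ds g => ds ++ [depOf ds g]) []

/-- The (unweighted) depth of a gate `g` placed behind a program whose gates have depths `ds`:
one plus the maximal depth of an argument wire (inputs have depth `0`, junk `0` out of range).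
(Vollmer 1999, §1.2.) [cite: Vollmer1999, §1.2] -/
def depthOf (ds : List ℕ) (g : Gate ι) : ℕ :=
  (fun _ => 1 : GateFn → ℕ) g.fn + univ.sup fun a => match g.args a with
    | .inl _ => 0
    | .inr m => ds.getD m 0

/-- The depths of all gates of the program `gs` (every gate weighs `1`), in program order; this
is `Circuit.depthVals _ (fun _ => 1)` for a bare gate list (`circuit_depthVals_one`).
(Vollmer 1999, §1.2.) [cite: Vollmer1999, §1.2] -/
def depths (gs : List (Gate ι)) : List ℕ :=
  gs.foldl (fun ds g => ds ++ [depthOf ds g]) []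

/-- `Circuit.depthVals` with unit weights is `GateList.depths` of the gate list
(definitional). [folklore] -/
theorem circuit_depthVals_one (C : Circuit ι) : C.depthVals (fun _ => 1) = depths C.gates := rfl

/-- Adding a gate appends its dependency set. [folklore] -/
theorem deps_append_singleton [DecidableEq ι] (gs : List (Gate ι)) (g : Gate ι) :
    deps (gs ++ [g]) = deps gs ++ [depOf (deps gs) g] := by
  simp [deps, List.foldl_append]

/-- Adding a gate appends its depth. [folklore] -/
theorem depths_append_singleton (gs : List (Gate ι)) (g : Gate ι) :
    depths (gs ++ [g]) = depths gs ++ [depthOf (depths gs) g] := by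
  simp [depths, List.foldl_append]

/-- A program with `L` gates has `L` dependency sets. [folklore] -/
@[simp] theorem length_deps [DecidableEq ι] (gs : List (Gate ι)) : (deps gs).length = gs.length := by
  induction gs using List.reverseRecOn with
  | nil => rfl
  | append_singleton gs g ih => simp [deps_append_singleton, ih]

/-- A program with `L` gates has `L` depths. [folklore] -/
@[simp] theorem length_depths (gs : List (Gate ι)) : (depths gs).length = gs.length := by
  induction gs using List.reverseRecOn with
  | nil => rfl
  | append_singleton gs g ih => simp [depths_append_singleton, ih]

/-- **Locality of straight-line programs.** The value of gate `m` only depends on the input bits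
in its dependency set: two inputs that agree on `(deps gs)[m]` give gate `m` the same value.
(Bravyi–Gosset–König 2018, §2: "the output bit `z_k` depends only on the input bits in its
light cone".) [cite: BravyiGossetKonigScience2018, §2 Eq. (5)] -/
theorem vals_getD_eq_of_agree [DecidableEq ι] (gs : List (Gate ι)) {x x' : ι → Bool} :
    ∀ m, (∀ i ∈ (deps gs).getD m ∅, x i = x' i) →
      (vals gs x).getD m false = (vals gs x').getD m false := by
  induction gs using List.reverseRecOn with
  | nil => intro m _; simp
  | append_singleton gs g ih =>
    intro m hm
    rw [deps_append_singleton] at hm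
    rw [vals_append_singleton, vals_append_singleton]
    rcases lt_or_ge m gs.length with h | h
    · rw [List.getD_append _ _ _ _ (by simpa using h),
        List.getD_append _ _ _ _ (by simpa using h)]
      rw [List.getD_append _ _ _ _ (by simpa using h)] at hm
      exact ih m hm
    · rw [List.getD_append_right _ _ _ _ (by simpa using h),
        List.getD_append_right _ _ _ _ (by simpa using h)]
      rw [List.getD_append_right _ _ _ _ (by simpa using h)] at hm
      rcases (Nat.sub_eq_zero_iff_le.mpr h |> fun _ => lt_or_ge (m - gs.length) 1) with h1 | h1
      · have h0 : m - (vals gs x).length = 0 := by simp; omega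
        have h0' : m - (vals gs x').length = 0 := by simp; omega
        have h0d : m - (deps gs).length = 0 := by simp; omega
        rw [h0, h0', List.getD_cons_zero, List.getD_cons_zero]
        rw [h0d, List.getD_cons_zero] at hm
        congr 1
        funext a
        cases ha : g.args a with
        | inl i =>
          simp only [wireOf_inl]
          apply hm
          simp only [depOf, mem_biUnion, mem_univ, true_and]
          exact ⟨a, by rw [ha]; simp⟩
        | inr m' =>
          simp only [wireOf_inr]
          apply ih
          intro i hi
          apply hm
          simp only [depOf, mem_biUnion, mem_univ, true_and]
          exact ⟨a, by rw [ha]; exact hi⟩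
      · have e1 : ∀ (l : List Bool), l.length = 1 → l.getD (m - gs.length) false = false :=
          fun l hl => List.getD_eq_default _ _ (by omega)
        rw [show (vals gs x).length = gs.length by simp, show (vals gs x').length = gs.length by simp,
          e1 _ rfl, e1 _ rfl]

/-- **Light cones of bounded fan-in programs are small.** If every gate of `gs` has fan-in
`≤ K` (`K ≥ 1`), the dependency set of gate `m` has at most `K ^ depth` elements.
(Bravyi–Gosset–König 2018, §2, Eq. (5): `|L(z_k)| ≤ K^d`.) [cite: BravyiGossetKonigScience2018, §2 Eq. (5)] -/
theorem card_deps_le [DecidableEq ι] (gs : List (Gate ι)) {K : ℕ} (hK : 1 ≤ K)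
    (hgs : ∀ g ∈ gs, g.arity ≤ K) :
    ∀ m, ((deps gs).getD m ∅).card ≤ K ^ ((depths gs).getD m 0) := by
  induction gs using List.reverseRecOn with
  | nil => intro m; simp
  | append_singleton gs g ih =>
    intro m
    have hgs' : ∀ g' ∈ gs, g'.arity ≤ K := fun g' hg' => hgs g' (by simp [hg'])
    have hg : g.arity ≤ K := hgs g (by simp)
    rw [deps_append_singleton, depths_append_singleton]
    rcases lt_or_ge m gs.length with h | h
    · rw [List.getD_append _ _ _ _ (by simpa using h),
        List.getD_append _ _ _ _ (by simpa using h)]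
      exact ih hgs' m
    · rw [List.getD_append_right _ _ _ _ (by simpa using h),
        List.getD_append_right _ _ _ _ (by simpa using h)]
      rcases lt_or_ge (m - gs.length) 1 with h1 | h1
      · have h0d : m - (deps gs).length = 0 := by simp; omega
        have h0e : m - (depths gs).length = 0 := by simp; omega
        rw [h0d, h0e, List.getD_cons_zero, List.getD_cons_zero]
        -- the new gate
        unfold depOf depthOf
        set D : Fin g.arity → ℕ := fun a => match g.args a with
          | .inl _ => 0
          | .inr m => (depths gs).getD m 0 with hD
        calc (univ.biUnion fun a => match g.args a with
                | .inl i => ({i} : Finset ι)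
                | .inr m => (deps gs).getD m ∅).card
            ≤ univ.card * K ^ (univ.sup D) := by
              apply card_biUnion_le_card_mul
              intro a _
              have hDa : D a ≤ univ.sup D := le_sup (mem_univ a)
              cases ha : g.args a with
              | inl i =>
                simp only [card_singleton]
                exact Nat.one_le_pow _ _ hK
              | inr m' =>
                calc ((deps gs).getD m' ∅).card ≤ K ^ ((depths gs).getD m' 0) := ih hgs' m'
                  _ = K ^ (D a) := by rw [hD]; simp only; rw [ha]
                  _ ≤ K ^ (univ.sup D) := Nat.pow_le_pow_right hK hDa
          _ ≤ K * K ^ (univ.sup D) := by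
              apply Nat.mul_le_mul_right
              simpa using hg
          _ = K ^ ((fun _ => 1 : GateFn → ℕ) g.fn + univ.sup D) := by
              simp only
              rw [pow_add, pow_one]
      · rw [List.getD_eq_default _ _ (by simp; omega)]
        simp

end GateList

namespace Circuit

/-- The (backward) *light cone* of the output of a circuit: the set of input variables from
which the output wire is reachable, i.e. `{i}` for an output wire `inl i` and the dependency
set of gate `m` for an output wire `inr m`. (Bravyi–Gosset–König 2018, §2, `L(z_k)`.) [cite: BravyiGossetKonigScience2018, §2 Eq. (5)] -/
def lightCone [DecidableEq ι] (C : Circuit ι) : Finset ι :=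
  match C.output with
  | .inl i => {i}
  | .inr m => (GateList.deps C.gates).getD m ∅

/-- **The output of a circuit only depends on the inputs in its light cone.**
(Bravyi–Gosset–König 2018, §2.) [cite: BravyiGossetKonigScience2018, §2 Eq. (5)] -/
theorem eval_congr_lightCone [DecidableEq ι] (C : Circuit ι) {x x' : ι → Bool}
    (h : ∀ i ∈ C.lightCone, x i = x' i) : C.eval x = C.eval x' := by
  unfold lightCone at h
  unfold eval
  cases ho : C.output with
  | inl i =>
    rw [ho] at h
    exact h i (by simp)
  | inr m =>
    rw [ho] at h
    exact GateList.vals_getD_eq_of_agree C.gates m h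

/-- **Light cones of bounded fan-in circuits are small**: if every gate of `C` has fan-in
`≤ K` with `K ≥ 1`, then `|lightCone C| ≤ K ^ depth C`. (Bravyi–Gosset–König 2018, §2,
Eq. (5).) [cite: BravyiGossetKonigScience2018, §2 Eq. (5)] -/
theorem card_lightCone_le [DecidableEq ι] (C : Circuit ι) {K : ℕ} (hK : 1 ≤ K)
    (hC : ∀ g ∈ C.gates, g.arity ≤ K) : C.lightCone.card ≤ K ^ C.depth := by
  unfold lightCone depth depthWith
  cases ho : C.output with
  | inl i => simp
  | inr m =>
    simp only
    rw [GateList.circuit_depthVals_one]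
    exact GateList.card_deps_le C.gates hK hC m

/-- Over the basis `B₂` (fan-in `≤ 2`) the light cone of a circuit of depth `d` has at most
`2 ^ d` input variables. (Bravyi–Gosset–König 2018, §2, Eq. (5) with `K = 2`.) [cite: BravyiGossetKonigScience2018, §2 Eq. (5)] -/
theorem card_lightCone_le_two_pow [DecidableEq ι] (C : Circuit ι) (hC : C.IsOver B2) :
    C.lightCone.card ≤ 2 ^ C.depth :=
  C.card_lightCone_le (Nat.le_succ 1) fun g hg => hC g hg

end Circuit

end Literature.Computability.Complexity
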